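import Summits.QuantumFields.GaugeBoot.BootstrapSymmetryReduction
import Summits.QuantumFields.GaugeBoot.BootstrapExactCertificates
import HarnessLib

/-!
# Invariant certificates: a bound on an invariant objective which is certified at level `n` is certified by a symmetry-INVARIANT certificate, with an equivariant Gram matrix (gauge-boot, L1/L4 supplement)

HONEST FRAMING (cell `pub-gaugeboot`, page 1 of every file): the venture produces certified bounds
on lattice expectations at stated coupling, gauge group, dimension and torus size; NOT a mass gap,
NOT a continuum limit, NOT a string tension; NOT Yang–Mills-summit-bearing (barriers
`FixedCouplingUltralocality`, `PerturbativeInvisibility`). Structural; it certifies no number.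

## Content (the DUAL side of `BootstrapSymmetryReduction.lean`)

`BootstrapSymmetryReduction` proved that the symmetry-reduced SDP has the same feasible values as
the full one for invariant objectives (primal side, Gatermann–Parrilo Thm 3.3). On the certificate
side:

* `comp_relabelCM_mem_sosCone`, `comp_relabelCM_mem_rowSet`, ★ `comp_relabelCM_mem_certCone` —
  a relabelling `U ↦ U ∘ π` compatible with the local actions maps the SOS cone, the row elements
  (the row of `f` at `i` goes to the row of `f ∘ π` at `π i`) and hence the certificate cone of a
  relabelling-stable test set into themselves;
* `avgObs` — the Reynolds operator `(1/|Γ|) Σ_γ x ∘ R_γ` on observables; `avgObs_comp_eq`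
  (invariant), `avgObs_of_invariant`, `avgObs_mem` (cones/subspaces stable under the family are
  stable under averaging);
* ★★★ `exists_invariant_certificate_suN` — `SU(N)` on the torus, any `β`, level `n`, the
  orientation-preserving lattice symmetries (translations and axis permutations,
  `latticeRelabel`): if `c • 1 - P` has a level-`n` certificate and `P` is invariant, then
  `c • 1 - P = σ + ρ` with `σ` an INVARIANT sum of squares of level-`n` test functions and `ρ` an
  INVARIANT combination of level-`n` loop equations; with exact duality
  (`sSup_smul_one_sub_mem_certCone_suN`): ★★★ `exists_invariant_certificate_sSup_suN` — the
  OPTIMAL level-`n` bound of an invariant objective has an invariant certificate;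
* ★★ `exists_equivariant_gram_of_invariant` (any lattice) — an invariant SOS element on the span of
  a finite family of test functions PERMUTED by the symmetry (`m (p_γ j) = m_j ∘ R_γ`) is the Gram
  form of a positive semidefinite matrix COMMUTING with the permutation representation
  (`Q (p_γ j) (p_γ l) = Q j l`) — the structure that block-diagonalisation of the reduced SDP
  exploits (Gatermann–Parrilo §5).

What this is NOT: the block-diagonalisation itself (isotypic decomposition of the permutation
representation — representation theory, not typed); reflections (see
`BootstrapSymmetryReduction`); rates.

References: K. Gatermann, P. A. Parrilo, J. Pure Appl. Algebra 192 (2004) 95, Thm 3.3 and §5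
(invariant sums of squares, equivariant Gram matrices); V. Kazakov, Z. Zheng, arXiv:2203.11360
§3.2. Folklore.
-/

noncomputable section

open MeasureTheory Filter Topology NormedSpace
open Literature.MathematicalPhysics.QuantumFieldTheory (LatticeRep Site Edge GaugeConfig wilsonAction
  wilsonMeasure isProbabilityMeasure_wilsonMeasure)
open Literature.MathematicalPhysics.QuantumLattice

namespace Summit.QuantumFields.GaugeBoot

/-! ## Relabellings preserve the certificate cone -/

section Relabel

variable {ι : Type*} [DecidableEq ι] {G : Type*} [Group G] [TopologicalSpace G] (r : LatticeRep G)
  {K : Type*} {k : K → ℝ → G} {S : ι → (ι → G) → ℝ} {β : ℝ}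

omit [DecidableEq ι] [Group G] in
/-- **The SOS cone of a relabelling-stable test set is relabelling stable.** -/
theorem comp_relabelCM_mem_sosCone (π : ι → ι) {V : Set C(ι → G, ℝ)}
    (hV : ∀ v ∈ V, v.comp (relabelCM (G := G) π) ∈ V) {x : C(ι → G, ℝ)} (hx : x ∈ sosCone V) :
    x.comp (relabelCM (G := G) π) ∈ sosCone V := by
  induction hx using Submodule.span_induction with
  | mem x hx =>
    obtain ⟨v, hv, rfl⟩ := hx
    exact mul_self_mem_sosCone (hV v hv)
  | zero => exact Submodule.zero_mem _
  | add x y _ _ hx hy => rw [ContinuousMap.add_comp]; exact Submodule.add_mem _ hx hy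
  | smul c x _ hx =>
    have h : (c • x).comp (relabelCM (G := G) π) = c • x.comp (relabelCM (G := G) π) := by
      ext U; rfl
    rw [h]
    exact Submodule.smul_mem _ c hx

/-- **Row elements go to row elements**: the row of `f` at the link `i` composed with `U ↦ U ∘ π`
is the row of `f ∘ π` at the link `π i` (compatible local actions `S_e (U ∘ π) = S_{π e} U`). -/
theorem comp_relabelCM_mem_rowSet (π : ι ≃ ι) (hS : ∀ e U, S e (relabelCM (G := G) π U) = S (π e) U)
    {V : Set C(ι → G, ℝ)} (hV : ∀ v ∈ V, v.comp (relabelCM (G := G) π) ∈ V) {x : C(ι → G, ℝ)}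
    (hx : x ∈ rowSet r k S β V) : x.comp (relabelCM (G := G) π) ∈ rowSet r k S β V := by
  obtain ⟨i, a, f, f', S', hf, hf', hS', hS'd, hf'd, rfl⟩ := hx
  refine ⟨π i, a, f.comp (relabelCM π), f'.comp (relabelCM π), S'.comp (relabelCM π), hV f hf,
    comp_relabelCM_mem_polyAlgebra r π hf', comp_relabelCM_mem_polyAlgebra r π hS',
    fun U => hasDerivAt_action_relabel π hS a i hS'd U,
    fun U => hasDerivAt_comp_relabelCM π (κ := k a) i hf'd U, ?_⟩
  ext U
  rfl

/-- **The row space is relabelling stable.** -/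
theorem comp_relabelCM_mem_rowSpace (π : ι ≃ ι) (hS : ∀ e U, S e (relabelCM (G := G) π U) = S (π e) U)
    {V : Set C(ι → G, ℝ)} (hV : ∀ v ∈ V, v.comp (relabelCM (G := G) π) ∈ V) {x : C(ι → G, ℝ)}
    (hx : x ∈ rowSpace r k S β V) : x.comp (relabelCM (G := G) π) ∈ rowSpace r k S β V := by
  have h : rowSpace r k S β V ≤ (rowSpace r k S β V).comap
      (ContinuousMap.compRightAlgHom ℝ ℝ (relabelCM (G := G) π)).toLinearMap :=
    Submodule.span_le.2 fun y hy => Submodule.subset_span (comp_relabelCM_mem_rowSet r π hS hV hy)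
  exact h hx

/-- ★ **The certificate cone is relabelling stable.** [cite: GatermannParrilo2004, §5] -/
theorem comp_relabelCM_mem_certCone (π : ι ≃ ι) (hS : ∀ e U, S e (relabelCM (G := G) π U) = S (π e) U)
    {V : Set C(ι → G, ℝ)} (hV : ∀ v ∈ V, v.comp (relabelCM (G := G) π) ∈ V) {x : C(ι → G, ℝ)}
    (hx : x ∈ certCone r k S β V) : x.comp (relabelCM (G := G) π) ∈ certCone r k S β V := by
  obtain ⟨σ, hσ, ρ, hρ, rfl⟩ := (mem_certCone_iff r).1 hx
  rw [ContinuousMap.add_comp]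
  exact (mem_certCone_iff r).2 ⟨_, comp_relabelCM_mem_sosCone π hV hσ, _,
    comp_relabelCM_mem_rowSpace r π hS hV hρ, rfl⟩

end Relabel

/-! ## The Reynolds operator on observables -/

section Reynolds

variable {ι : Type*} {G : Type*} [TopologicalSpace G] {Γ : Type*} [Fintype Γ]

/-- **The Reynolds operator on observables**: `(1/|Γ|) Σ_γ x ∘ R_γ`. [cite: GatermannParrilo2004,
§5] -/
def avgObs (R : Γ → C(ι → G, ι → G)) (x : C(ι → G, ℝ)) : C(ι → G, ℝ) :=
  (Fintype.card Γ : ℝ)⁻¹ • ∑ γ, x.comp (R γ)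

/-- **The averaged observable is invariant** (family closed under composition up to a permutation
of the indices). -/
theorem avgObs_comp_eq (R : Γ → C(ι → G, ι → G))
    (hR : ∀ δ, ∃ e : Γ ≃ Γ, ∀ γ, (R γ).comp (R δ) = R (e γ)) (x : C(ι → G, ℝ)) (δ : Γ) :
    (avgObs R x).comp (R δ) = avgObs R x := by
  obtain ⟨e, he⟩ := hR δ
  have hsum : (∑ γ, x.comp (R γ)).comp (R δ) = ∑ γ, x.comp (R γ) := by
    have h1 : (∑ γ, x.comp (R γ)).comp (R δ) = ∑ γ, (x.comp (R γ)).comp (R δ) := by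
      ext U; simp [ContinuousMap.sum_apply]
    rw [h1]
    have h2 : ∀ γ, (x.comp (R γ)).comp (R δ) = x.comp (R (e γ)) := fun γ => by
      rw [ContinuousMap.comp_assoc, he γ]
    simp_rw [h2]
    exact Fintype.sum_equiv e _ _ fun γ => rfl
  unfold avgObs
  ext U
  have := congrArg (fun f : C(ι → G, ℝ) => f U) hsum
  simp only [ContinuousMap.comp_apply] at this
  simp only [ContinuousMap.smul_apply, ContinuousMap.comp_apply, smul_eq_mul, this]

/-- **On invariant observables the Reynolds operator is the identity.** -/
theorem avgObs_of_invariant [Nonempty Γ] (R : Γ → C(ι → G, ι → G)) {x : C(ι → G, ℝ)}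
    (hx : ∀ γ, x.comp (R γ) = x) : avgObs R x = x := by
  unfold avgObs
  simp only [hx, Finset.sum_const, Finset.card_univ, ← Nat.cast_smul_eq_nsmul ℝ, smul_smul]
  rw [inv_mul_cancel₀ (Nat.cast_ne_zero.2 Fintype.card_ne_zero), one_smul]

/-- **A pointed cone stable under the family is stable under averaging.** -/
theorem avgObs_mem [Nonempty Γ] (R : Γ → C(ι → G, ι → G)) (C : PointedCone ℝ C(ι → G, ℝ))
    (hC : ∀ γ, ∀ x ∈ C, x.comp (R γ) ∈ C) {x : C(ι → G, ℝ)} (hx : x ∈ C) : avgObs R x ∈ C := by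
  unfold avgObs
  have hc : (0 : ℝ) ≤ (Fintype.card Γ : ℝ)⁻¹ := inv_nonneg.2 (Nat.cast_nonneg _)
  exact OrderUnitDuality.smul_mem_of_nonneg hc (Submodule.sum_mem _ fun γ _ => hC γ x hx)

/-- **A subspace stable under the family is stable under averaging.** -/
theorem avgObs_mem_submodule (R : Γ → C(ι → G, ι → G)) (W : Submodule ℝ C(ι → G, ℝ))
    (hW : ∀ γ, ∀ x ∈ W, x.comp (R γ) ∈ W) {x : C(ι → G, ℝ)} (hx : x ∈ W) : avgObs R x ∈ W := by
  unfold avgObs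
  exact Submodule.smul_mem _ _ (Submodule.sum_mem _ fun γ _ => hW γ x hx)

/-- The Reynolds operator is additive. -/
theorem avgObs_add (R : Γ → C(ι → G, ι → G)) (x y : C(ι → G, ℝ)) :
    avgObs R (x + y) = avgObs R x + avgObs R y := by
  unfold avgObs
  rw [← smul_add, ← Finset.sum_add_distrib]
  congr 1

end Reynolds

/-! ## `SU(N)` on the torus: invariant certificates for the lattice symmetries -/

section SuN

variable {d L : ℕ} [NeZero L] (N : ℕ) (β : ℝ) (n : ℕ)

omit [NeZero L] in
/-- **Closure of the lattice family under composition, inner form**: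
`e_{(τ,b)} ∘ e_{(σ,a)} = e_{(τσ, b + τ·a)}`, a permutation of the inner index. -/
theorem latticeRelabel_closed_inner (δ : Equiv.Perm (Fin d) × Site d L) :
    ∃ g : (Equiv.Perm (Fin d) × Site d L) ≃ (Equiv.Perm (Fin d) × Site d L),
      ∀ γ, (⇑(latticeRelabel (L := L) δ)) ∘ (⇑(latticeRelabel γ)) = ⇑(latticeRelabel (g γ)) := by
  refine ⟨Equiv.prodCongr (Equiv.mulLeft δ.1)
    ((Literature.MathematicalPhysics.QuantumFieldTheory.sitePerm (L := L) δ.1).trans (Equiv.addLeft δ.2)),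
    fun γ => ?_⟩
  rw [show δ = (δ.1, δ.2) from rfl, show γ = (γ.1, γ.2) from rfl, latticeRelabel_comp]
  rfl

omit [NeZero L] in
/-- The relabellings by the lattice symmetries, as a family closed under composition (inner form,
on the configuration maps). -/
theorem relabelCM_latticeRelabel_closed (δ : Equiv.Perm (Fin d) × Site d L) :
    ∃ g : (Equiv.Perm (Fin d) × Site d L) ≃ (Equiv.Perm (Fin d) × Site d L), ∀ γ,
      (relabelCM (G := Matrix.specialUnitaryGroup (Fin N) ℂ) (latticeRelabel (L := L) γ)).comp
          (relabelCM (latticeRelabel δ)) =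
        relabelCM (latticeRelabel (g γ)) := by
  obtain ⟨g, hg⟩ := latticeRelabel_closed_inner (L := L) δ
  refine ⟨g, fun γ => ?_⟩
  ext U ℓ
  have h := congrFun (hg γ) ℓ
  simp only [Function.comp_apply] at h
  simp only [ContinuousMap.comp_apply, relabelCM_apply, h]

/-- ★★★ **Invariant certificates suffice** (`SU(N)`, torus `(ℤ/L)^d`, any real `β`, level `n`,
the orientation-preserving lattice symmetries): if `c • 1 - P` has a level-`n` SOS ⊕ loop-equation
certificate and the objective `P` is invariant under all translations and axis permutations, then
`c • 1 - P = σ + ρ` with `σ` an INVARIANT element of the level-`n` SOS cone and `ρ` an INVARIANT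
element of the level-`n` row space. [cite: GatermannParrilo2004, Thm 3.3, §5] -/
theorem exists_invariant_certificate_suN
    {P : C(GaugeConfig d L (Matrix.specialUnitaryGroup (Fin N) ℂ), ℝ)}
    (hP : ∀ p : Equiv.Perm (Fin d) × Site d L,
      P.comp (relabelCM (G := Matrix.specialUnitaryGroup (Fin N) ℂ) (latticeRelabel p)) = P)
    {c : ℝ} (hc : c • (1 : C(GaugeConfig d L (Matrix.specialUnitaryGroup (Fin N) ℂ), ℝ)) - P ∈
      certConeSuN (d := d) (L := L) N β n) :
    ∃ σ ∈ sosCone (wordTruncation (ι := Edge d L) (fundamentalLatticeRep N) n),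
      ∃ ρ ∈ rowSpace (fundamentalLatticeRep N) (suExp N)
        (fun _ : Edge d L => wilsonAction (fundamentalRep (Fin N))) β
        (wordTruncation (ι := Edge d L) (fundamentalLatticeRep N) n),
      (∀ p : Equiv.Perm (Fin d) × Site d L,
          σ.comp (relabelCM (G := Matrix.specialUnitaryGroup (Fin N) ℂ) (latticeRelabel p)) = σ) ∧
        (∀ p : Equiv.Perm (Fin d) × Site d L,
          ρ.comp (relabelCM (G := Matrix.specialUnitaryGroup (Fin N) ℂ) (latticeRelabel p)) = ρ) ∧
        σ + ρ = c • (1 : C(GaugeConfig d L (Matrix.specialUnitaryGroup (Fin N) ℂ), ℝ)) - P := by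
  obtain ⟨σ, hσ, ρ, hρ, hsum⟩ := (mem_certCone_iff (fundamentalLatticeRep N)).1 hc
  set R : Equiv.Perm (Fin d) × Site d L →
      C(GaugeConfig d L (Matrix.specialUnitaryGroup (Fin N) ℂ), GaugeConfig d L (Matrix.specialUnitaryGroup (Fin N) ℂ)) :=
    fun p => relabelCM (G := Matrix.specialUnitaryGroup (Fin N) ℂ) (latticeRelabel p) with hRdef
  have hR : ∀ δ, ∃ g : _ ≃ _, ∀ γ, (R γ).comp (R δ) = R (g γ) := relabelCM_latticeRelabel_closed N
  have hV : ∀ (p : Equiv.Perm (Fin d) × Site d L),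
      ∀ v ∈ wordTruncation (ι := Edge d L) (fundamentalLatticeRep N) n,
        v.comp (R p) ∈ wordTruncation (ι := Edge d L) (fundamentalLatticeRep N) n :=
    fun p v hv => comp_relabelCM_mem_wordTruncation (fundamentalLatticeRep N) _ hv
  have hS : ∀ (p : Equiv.Perm (Fin d) × Site d L) (e : Edge d L)
      (U : GaugeConfig d L (Matrix.specialUnitaryGroup (Fin N) ℂ)),
      (fun _ : Edge d L => wilsonAction (fundamentalRep (Fin N))) e (relabelCM (latticeRelabel p) U) =
        (fun _ : Edge d L => wilsonAction (fundamentalRep (Fin N))) (latticeRelabel p e) U :=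
    fun p e U => wilsonAction_comp_latticeRelabel N p U
  refine ⟨avgObs R σ, avgObs_mem R _ (fun p x hx => comp_relabelCM_mem_sosCone _ (hV p) hx) hσ,
    avgObs R ρ, avgObs_mem_submodule R _
      (fun p x hx => comp_relabelCM_mem_rowSpace (fundamentalLatticeRep N) _ (hS p) (hV p) hx) hρ,
    fun p => avgObs_comp_eq R hR σ p, fun p => avgObs_comp_eq R hR ρ p, ?_⟩
  have hinv : ∀ p, (c • (1 : C(GaugeConfig d L (Matrix.specialUnitaryGroup (Fin N) ℂ), ℝ)) - P).comp (R p) =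
      c • (1 : C(GaugeConfig d L (Matrix.specialUnitaryGroup (Fin N) ℂ), ℝ)) - P := fun p => by
    rw [ContinuousMap.sub_comp, hP p]
    rfl
  rw [← avgObs_add, hsum, avgObs_of_invariant R hinv]

/-- ★★★ **The optimal level-`n` bound of an invariant objective has an invariant certificate**
(exact duality `sSup_smul_one_sub_mem_certCone_suN` + `exists_invariant_certificate_suN`).
[cite: GatermannParrilo2004, Thm 3.3, §5] -/
theorem exists_invariant_certificate_sSup_suN
    {P : C(GaugeConfig d L (Matrix.specialUnitaryGroup (Fin N) ℂ), ℝ)}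
    (hPd : P ∈ certDomainSuN (d := d) (L := L) N β n)
    (hP : ∀ p : Equiv.Perm (Fin d) × Site d L,
      P.comp (relabelCM (G := Matrix.specialUnitaryGroup (Fin N) ℂ) (latticeRelabel p)) = P) :
    ∃ σ ∈ sosCone (wordTruncation (ι := Edge d L) (fundamentalLatticeRep N) n),
      ∃ ρ ∈ rowSpace (fundamentalLatticeRep N) (suExp N)
        (fun _ : Edge d L => wilsonAction (fundamentalRep (Fin N))) β
        (wordTruncation (ι := Edge d L) (fundamentalLatticeRep N) n),
      (∀ p : Equiv.Perm (Fin d) × Site d L,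
          σ.comp (relabelCM (G := Matrix.specialUnitaryGroup (Fin N) ℂ) (latticeRelabel p)) = σ) ∧
        (∀ p : Equiv.Perm (Fin d) × Site d L,
          ρ.comp (relabelCM (G := Matrix.specialUnitaryGroup (Fin N) ℂ) (latticeRelabel p)) = ρ) ∧
        σ + ρ = sSup (levelValuesSuN (d := d) (L := L) N β n P) •
          (1 : C(GaugeConfig d L (Matrix.specialUnitaryGroup (Fin N) ℂ), ℝ)) - P :=
  exists_invariant_certificate_suN N β n hP (sSup_smul_one_sub_mem_certCone_suN N β hPd)

end SuN

end Summit.QuantumFields.GaugeBoot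

end
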